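import Literature.NumberTheory.Automorphic.Liu2021.AppendixD.SecD3CohomologyUnitaryCurves
import Literature.NumberTheory.Automorphic.Liu2021.AppendixC.DefC1toC3Aux
import Literature.NumberTheory.Automorphic.UnitaryGroupHyperspecialHecke
import Literature.AlgebraicGeometry.Motives.GoodReduction
import Literature.AlgebraicGeometry.ModuliOfCurves.SemiStableCurves
import Literature.AlgebraicGeometry.Motives.FrobeniusMorphism
import HarnessLib

/-!
# Liu 2021, Appendix D §D.4 «Proof of Theorem D.6» — the standing data (`𝔮`, `K_Iw`, `t_ϖ`, `𝒮_K`, `𝒮_{K_Iw}`, `𝒯`),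
# Proposition D.8, Corollary D.9 and the paragraph l. 5626–5627 of the proof of Theorem D.6 (1), EXACTLY AS PRINTED
# (statement-exact typing over the §D.3 datum `SecD3Data` of the sibling `SecD3CohomologyUnitaryCurves`; NO proof)

[Liu2021] = Yifeng Liu, *Fourier–Jacobi cycles and arithmetic relative trace formula*, Cambridge J. Math. **9** (2021), no. 1,
1–147 = arXiv:2102.11518.  SOURCES READ: the PRINT (`paper:liu2021-fourier-jacobi-cycles-arithmetic-relative-trace-formula`,
page file `pNNNN` = journal page `N`): §D.4 opens p. 134 L18, Prop. D.8 p. 135 L5, Cor. D.9 p. 138 L44, proof of Thm. D.6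
p. 139 L84 – p. 140 L45; and the TeX of record `FJcycle.tex` (md5 `6db49a74122d2cb0f224fa1b39488a0c`): §D.4 =
`\subsection{Proof of Theorem \ref{th:galois_curve}}` l. 5497 (label `ss:proof_curve`), Prop. D.8 = `pr:congruence`
l. 5522–5540, Cor. D.9 = `co:congruence` l. 5579–5585, the paragraph l. 5626–5627.  Print and TeX agree word for word on the
sentences typed (the print writes [Liu11b], [DR73, KM85] for the TeX's `\cite{Liu12}`, `\cites{DR72,KM85}`).

EDITION 2 (review-class fix of the landed edition 1, p848095: the reviewer's advisory «the printed shape of `K`, `K_Iw`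
(hyperspecial at `p`, Iwahori) and of `t = (0 ϖ; 1 0)` is recorded but not pinned» is answered by REAL pins — `𝔮 : PlacesOver E 𝔭`
with `split : c • 𝔮 ≠ 𝔮`, `gramUnit`, `K_hyperspecial` (tree `UnitaryGroup.IsHyperspecialAt`), `KIw_spec` (Iwahori condition
through the tree's split frame `UnitaryGroup.localPiSplitEquiv`), the Hecke operators of Cor. D.9 as the tree's
`UnitaryGroup.heckeTAt` (no posited elements), `t_ϖ ⊗ σ` pinned by its two projections, and the absolute Frobenius of (3d) REAL
as the tree's `Motives.frobeniusOver`; and «EXACTLY AS PRINTED» is no longer claimed for D.8 (2)).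

Second half of the App. D §D.3–§D.4 carpet of squad TL «Liu FJ∕418» (cell hodgecm-mathlib, seat TL-t07; deal sheet
`T/LIU/TL-plan/g0/SPLIT-TL.v1`, re-deal 2026-09-02T02:08Z): the §D.3 datum `SecD3Data` (fields `τ'₁`, `V`, the curves
`S̄h(G,h)_K = D.ShBar K` with their transition maps `D.trBar` and Jacobians `D.jac`, `G(𝔸^∞) = D.V.Gfin`, the classes `D.Irr`,
the triples `D.Triple`, …) and its `ℓ`-adic companion `SecD3Data.EllAdic` (`H¹_ét`, `ρet`, `γet`, `H1etLevel`) are IMPORTED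
from the sibling and not re-posited.  Conventions as there: every numbered item is a `Prop`-valued PREDICATE on posited data;
**NOTHING IS ASSERTED**; 0 closed named facts, no `sorry`, no `axiom`, no `instance`/instance attribute, no notation; REAL
Mathlib/tree notions wherever they exist (`HeightOneSpectrum (𝓞 E)`, `adicCompletionIntegers`, `Ideal.ramificationIdx`,
`Motives.IntegralModel`/`reduction`, `ModuliOfCurves.IsSemiStableCurve`, `irreducibleComponents`, `IsFinite`, `Flat`,
`IsGeomFrobAt`, `primesAbove`, `ComplexMultiplication.traceField`), ⟨CARRIER⟩ fields otherwise, each with the printed clause.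
DEDUP: the cell's kernel-side `AppendixC/RecordCurveCorD9OfEichlerShimura` / `RecordCurveEichlerShimura` (Cor. D.9 transported
to the Albanese tower) and the `AlgebraicGeometry/Motives/IntegralModel*`, `AbelianSchemes/Frobenius*` files (which take
Prop. D.8 as INPUT) assert no printed text and are not duplicated here.

## The printed text (verbatim; macros resolved as in the sibling)

**§D.4, standing data** (l. 5500–5520; p. 134 L18 – p. 135 L4): «… we fix a prime `𝔮` of `E`, with the underlying rational
prime `p`, such that • `G ⊗_ℚ ℚ_p` is unramified (in particular, `p` is unramified in `E`), and • `𝔮 ≠ 𝔮^c`, that is, `𝔮` has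
degree `1` over `F`.  Denote by `𝔭` the prime of `F` underlying `𝔮`. We identify `F_𝔭` with `E_𝔮`. Choose a uniformizer `ϖ` of
`F_𝔭`. Put `𝒪_𝔭 := O_{F_𝔭}`, `κ := 𝒪_𝔭/ϖ𝒪_𝔭`, and `q := #κ`. Fix a maximal unramified extension `F_𝔭^{ur}` … `κ^{ac}` the
residue field. Let `σ : 𝒪_𝔭^{ur} → 𝒪_𝔭^{ur}` be the `q`-th Frobenius map.  Fix a basis of the `E_𝔮`-vector space `V ⊗_E E_𝔮`
under which we identify `U(V ⊗_F F_𝔭)` with `GL_{2,F_𝔭}`. Let `Iw_𝔭 := (𝒪_𝔭 𝒪_𝔭; ϖ𝒪_𝔭 𝒪_𝔭) ⊆ GL₂(𝒪_𝔭)` be an Iwahori subgroup.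
We consider open compact subgroups `K ⊆ G(𝔸^∞)` of the form `GL₂(𝒪_𝔭) × K_p^𝔭 × K^p` where `GL₂(𝒪_𝔭) × K_p^𝔭` is a hyperspecial
maximal subgroup of `G(ℚ_p)` and `K^p` is a sufficiently small open compact subgroup of `G(𝔸^{∞,p})`. For such `K`, we put
`K_Iw := Iw_𝔭 × K_p^𝔭 × K^p`. We have the projection morphism `π : S̄h(G,h)_{K_Iw} → S̄h(G,h)_K`, and an isomorphism
`t_ϖ : S̄h(G,h)_{K_Iw} ≃ S̄h(G,h)_{K_Iw}` induced by the Hecke translation of the element `(0 ϖ; 1 0)`. In view of the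
reciprocity map in Remark C.2, the morphism `t_ϖ ⊗ σ : S̄h(G,h)_{K_Iw} ⊗_{F_𝔭} F_𝔭^{ur} → S̄h(G,h)_{K_Iw} ⊗_{F_𝔭} F_𝔭^{ur}`
preserves every connected component.  We will show in Proposition D.8 that `S̄h(G,h)_K` (resp. `S̄h(G,h)_{K_Iw}`) admits a smooth
model (resp. a stable model) `𝒮_K` (resp. `𝒮_{K_Iw}`) over `𝒪_𝔭`. By [LL99, Proposition 4.4(a)], the morphism `t_ϖ` extends
(uniquely) to a morphism `t_ϖ : 𝒮_{K_Iw} → 𝒮_{K_Iw}`, which has to be an isomorphism; and `π` extends (uniquely) to a morphism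
`π : 𝒮_{K_Iw} → 𝒮_K`. Finally, to ease notation, we put `𝒯_K := 𝒮_K ⊗_{𝒪_𝔭} κ` and `𝒯_{K_Iw} := 𝒮_{K_Iw} ⊗_{𝒪_𝔭} κ` for the
special fibers.»

**PROPOSITION D.8** (l. 5522–5540; p. 135 L5–17): «Let the notation be as above. We have
 (1) The smooth projective `F_𝔭`-curve `S̄h(G,h)_K` admits a smooth model `𝒮_K` over `𝒪_𝔭`.
 (2) The smooth projective `F_𝔭`-curve `S̄h(G,h)_{K_Iw}` admits a stable model `𝒮_{K_Iw}` over `𝒪_𝔭`.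
 (3) The `κ`-scheme `𝒯_{K_Iw}` has two irreducible components `𝒯_{K_Iw}^+` and `𝒯_{K_Iw}^−`, satisfying that
     (a) `π^+ := π|𝒯_{K_Iw}^+ : 𝒯_{K_Iw}^+ → 𝒯_K` is an isomorphism;
     (b) `π^− := π|𝒯_{K_Iw}^− : 𝒯_{K_Iw}^− → 𝒯_K` is a finite flat morphism of degree `q`;
     (c) `t_ϖ ⊗ σ` induces an isomorphism between `𝒯_{K_Iw}^+ ⊗_κ κ^{ac}` and `𝒯_{K_Iw}^− ⊗_κ κ^{ac}`;
     (d) the morphism `(π^− ⊗ id) ∘ (t_ϖ ⊗ σ) ∘ (π^+ ⊗ id)^{−1}` coincides with the absolute `q`-th Frobenius morphism of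
         `𝒯_K ⊗_κ κ^{ac}`.»   (Proof l. 5542–5576, pp. 135–138, NOT formalised: [Car86] §§0.1–10.3, [Del79], [DM69, §1],
         [Buz97], [DR73, KM85], [SP, 0CCZ].)

**COROLLARY D.9** (l. 5579–5585; p. 138 L44 – p. 139 L2): «For every rational prime `ℓ ≠ p`, the action `(σ^{−1})^*` of the
*geometric* Frobenius at `𝔮` on `H¹_ét(S̄h(G,h)_K ⊗_E ℂ, ℚ_ℓ^{ac})` satisfies the equation `X² − t_ϖ^* X + q ⟨ϖ⟩^* = 0`, where
`⟨ϖ⟩ : S̄h(G,h)_K → S̄h(G,h)_K` is the Hecke translation given by `(ϖ 0; 0 ϖ)`. Here, we regard `t_ϖ` as a correspondence on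
`S̄h(G,h)_K`.»  (Proof l. 5587–5615, p. 139, from Prop. D.8 (3), (3a), (3d); NOT formalised.)

**§D.4, l. 5626–5627** (p. 140 L20–31; the paragraph of the proof of Thm. D.6 (1) that 23 tree files cite as «§D.4 (FJcycle.tex
l. 5626–5627)»): «Fix an open compact subgroup `K ⊆ G(𝔸^∞)` such that `(π^K)^∞ ≠ {0}`. Let `A_K` be the Jacobian of
`S̄h(G,h)_K`. Let `π̲^∞` be the `Gal(ℂ/ℚ)`-orbit of `π^∞`. Using Hecke operators, we may find a surjective homomorphism
`φ : A_K → B` of abelian varieties over `E` such that the induced map `φ^* : H¹_B(B, ℚ) → H¹_B(A_K, ℚ)[π̲^∞]` is an isomorphism.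
Let `B₀` be some simple factor of `B` over `E`. Then `B₀` has complex multiplications by some subfield `M₀ ⊆ ℂ`, which has to
contain `M'_μ` (Definition 4.3).»

## The typing

* ⟨CARRIER⟩/REAL `SecD4Data D` — the §D.4 standing data over the §D.3 datum `D` (see its docstring); `SecD4Data.Liu2021_D8_1`,
  `_D8_2`, `_D8_3`, `_D8_3a`, `_D8_3b`, `_D8_3cd`, `_D8` (Prop. D.8, one predicate per printed sub-item so that closers can
  cite one), `SecD4Data.heckeT` + `SecD4Data.Liu2021_D9` (Cor. D.9, for an `ℓ`-adic datum `L : D.EllAdic ℓ` of the sibling, with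
  the tree's REAL Hecke operators `UnitaryGroup.heckeTAt` at the split place `𝔮`), `BettiQData D` +
  `Liu2021_D4par_heckeProjection` (the l. 5626–5627 paragraph).
* NOT TYPED (recorded verbatim above): the clause «of degree `q`» of Prop. D.8 (3b) (no rank of a finite flat morphism in
  Mathlib); the STABILITY refinement of «stable model» in (2) beyond semi-stability; the CONSTRUCTION of «`t_ϖ ⊗ σ`» (a ⟨CARRIER⟩
  endomorphism pinned by its two projections); all proofs ([Car86], [Del79], [DM69], [Buz97],
  [DR73, KM85], [SP 0CCZ], [LL99]; locators in `shelf/Liu2021-AppD3-D4-Thm415-ProofInputs.md`).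

## References
* [Liu2021] Y. Liu, Camb. J. Math. 9 (2021) = arXiv:2102.11518: App. D §D.4 (l. 5497–5633; pp. 134–140); Def. 4.3 (p. 41).
* [SerreTate1968] §1 (the tree's `Motives.IntegralModel`); [deJong1996] 2.21 (the tree's `ModuliOfCurves.IsSemiStableCurve`);
  [LL99] Q. Liu, D. Lorenzini, Compositio 118 (1999) Prop. 4.4 (a); [Car86] H. Carayol, Compositio 59 (1986) — as printed.
-/

noncomputable section

open NumberField CategoryTheory AlgebraicGeometry
open Literature.AlgebraicGeometry.Motives (CMType SchemeOver AbelianVariety Jacobian IsSmoothProjective IntegralModel)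
open Literature.AlgebraicGeometry.ModuliOfCurves (IsSemiStableCurve)
open Literature.NumberTheory.GaloisRepresentations (HeckeCharacter)
open Literature.NumberTheory.Automorphic.Liu2021.AppendixD.SecD3CohomologyUnitaryCurves

namespace Literature.NumberTheory.Automorphic.Liu2021.AppendixD.SecD4ProofOfThmD6

variable {F E : Type} [Field F] [NumberField F] [IsTotallyReal F] [Field E] [NumberField E] [Algebra F E]
  [IsTotallyComplex E] [Algebra.IsQuadraticExtension F E]
variable (D : SecD3Data F E)

/-! ## §D.4 «Proof of Theorem D.6»: standing data (l. 5500–5520; p. 134 L18 – p. 135 L4) -/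

/-- ⟨CARRIER⟩ **The standing data of [Liu2021, App. D §D.4]** (l. 5500–5520) for the datum `D`: the prime `𝔮` of `E` of
degree `1` over `F` (REAL: a place `𝔮` of `E` over a place `𝔭` of `F` with `c • 𝔮 ≠ 𝔮`) over the rational prime `p`, «unramified in `E`» (REAL);
`𝒪_𝔭 = O_{F_𝔭} = O_{E_𝔮}` and `F_𝔭 = E_𝔮` (REAL: Mathlib `𝔮.adicCompletionIntegers E ⊆ 𝔮.adicCompletion E`; «We identify
`F_𝔭` with `E_𝔮`», l. 5508), `κ`, `q = #κ`, `κ^{ac}`; the two levels `K = GL₂(𝒪_𝔭) × K_p^𝔭 × K^p` and `K_Iw = Iw_𝔭 × K_p^𝔭 × K^p`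
(subgroups of `G(𝔸^∞) = UnitaryGroup.finAdelic …` with REAL pins: `K` hyperspecial-and-factorisable at the places over `p` —
tree `UnitaryGroup.IsHyperspecialAt` —, `K_Iw` = the Iwahori sub-level read through the tree's split frame
`UnitaryGroup.localPiSplitEquiv … 𝔮 : U(J)(F_𝔭) ≃ GL₂(E_𝔮)`, which IS «the identification of `U(V ⊗_F F_𝔭)` with `GL_{2,F_𝔭}`» of
l. 5510, available because `𝔭` splits (`split`) and the Gram matrix is a unit at `𝔮` (`gramUnit`)); the Hecke operators `t_ϖ^*`,
`⟨ϖ⟩^*` of Cor. D.9 are then the tree's `UnitaryGroup.heckeTAt … 𝔮 … ϖ 1` and `… ϖ 2` (no posited elements);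
the projection `π : S̄h_{K_Iw} → S̄h_K` (REAL: the transition map `D.trBar`), the automorphism `t_ϖ` of `S̄h_{K_Iw}` and `⟨ϖ⟩` of
`S̄h_K` (⟨CARRIER⟩ isomorphisms); the models `𝒮_K`, `𝒮_{K_Iw}` over `𝒪_𝔭` of the base changes to `F_𝔭` (the tree's
`Motives.IntegralModel`) with the extensions of `π` and `t_ϖ` (l. 5520, [LL99, Prop. 4.4 (a)]) and their generic-fibre
compatibilities (REAL); the special fibres `𝒯_K`, `𝒯_{K_Iw}` (REAL: `IntegralModel.reduction` modulo the maximal ideal); the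
two components `𝒯^±_{K_Iw}` as closed subschemes (⟨CARRIER⟩); and over `κ^{ac}` the morphism «`t_ϖ ⊗ σ`» (⟨CARRIER⟩
endomorphism PINNED by its two projections: over `t_ϖ ⊗ κ` and over the `q`-th power map of `κ^{ac}`); «the absolute `q`-th Frobenius
morphism of `𝒯_K ⊗_κ κ^{ac}`» is REAL: the tree's `Motives.frobeniusOver` (identity on points, `s ↦ s^q` on functions, `q = #κ`) of
`𝒯_K ⊗_κ κ^{ac}` regarded over `κ`.  Nothing is asserted. [cite: Liu2021, App. D §D.4 (l. 5500–5520; p. 134 L18 – p. 135 L4)] -/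
structure SecD4Data (D : SecD3Data F E) : Type 1 where
  /-- «Denote by `𝔭` the prime of `F` underlying `𝔮`» (l. 5508). REAL: a finite place of `F`. -/
  𝔭 : IsDedekindDomain.HeightOneSpectrum (𝓞 F)
  /-- «we fix a prime `𝔮` of `E`» (l. 5502) lying over `𝔭` (l. 5508). REAL: the tree's `UnitaryGroup.PlacesOver E 𝔭`
  (`𝔮.1 : HeightOneSpectrum (𝓞 E)` with `𝔮.1.under (𝓞 F) = 𝔭`). -/
  𝔮 : UnitaryGroup.PlacesOver E 𝔭
  /-- «`𝔮 ≠ 𝔮^c`, that is, `𝔮` has degree `1` over `F`» (l. 5506) — REAL: `𝔮` is moved by the complex conjugation `c = conj F E`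
  (the tree's action of `E ≃ₐ[F] E` on the finite places of `E`, `GaloisActionPlaces`), i.e. `𝔭` SPLITS in `E`. -/
  split : AppendixC.conj F E • 𝔮.1 ≠ 𝔮.1
  /-- «with the underlying rational prime `p`» (l. 5502). -/
  p : ℕ
  /-- `p` is prime. -/
  p_prime : p.Prime
  /-- `p` lies under `𝔮`: `p ∈ 𝔮`. -/
  p_mem : (p : 𝓞 E) ∈ 𝔮.1.asIdeal
  /-- «(in particular, `p` is unramified in `E`)» (l. 5504): every prime of `E` above `p` has ramification index `1` over `ℤ`
  (Mathlib `Ideal.ramificationIdx`). -/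
  p_unramified : ∀ w : IsDedekindDomain.HeightOneSpectrum (𝓞 E), (p : 𝓞 E) ∈ w.asIdeal →
    w.asIdeal.ramificationIdx ℤ = 1
  /-- «Fix a basis of the `E_𝔮`-vector space `V ⊗_E E_𝔮` under which we identify `U(V ⊗_F F_𝔭)` with `GL_{2,F_𝔭}`» (l. 5510) —
  REAL: the Gram matrix `J = D.V.gram` of the datum's basis is a unit at `𝔮` (`J ∈ GL₂(𝒪_{E_𝔮})`), so that the tree's SPLIT FRAME
  `e_𝔮 = UnitaryGroup.localPiSplitEquiv c J _ _ 𝔮 split gramUnit : U(J)(F_𝔭) ≃ GL₂(E_𝔮)` (`UnitaryGroupSplitPlace`) is the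
  printed identification (`E_𝔮 = F_𝔭`, l. 5508). -/
  gramUnit : IsUnit (UnitaryGroup.placeForm D.V.gram 𝔮.1)
  /-- The level «`K = GL₂(𝒪_𝔭) × K_p^𝔭 × K^p` where `GL₂(𝒪_𝔭) × K_p^𝔭` is a hyperspecial maximal subgroup of `G(ℚ_p)` and `K^p` is a
  sufficiently small open compact subgroup of `G(𝔸^{∞,p})`» (l. 5510): a subgroup of `G(𝔸^∞)` with the REAL attributes
  `K_level` (neat open compact) and `K_hyperspecial` (hyperspecial-and-factorisable at every place of `F` over `p`, the tree's
  `UnitaryGroup.IsHyperspecialAt`, `UnitaryGroupHyperspecialHecke` D2; «`G ⊗_ℚ ℚ_p` is unramified», l. 5504, is what makes such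
  `K` exist and is otherwise not typed). -/
  K : Subgroup D.V.Gfin
  /-- `K` is a neat open compact subgroup (a level of the system; «sufficiently small», l. 5510). REAL. -/
  K_level : D.S.IsNeat K ∧ IsOpen (K : Set D.V.Gfin) ∧ IsCompact (K : Set D.V.Gfin)
  /-- `K = GL₂(𝒪_𝔭) × K_p^𝔭 × K^p` with `GL₂(𝒪_𝔭) × K_p^𝔭` hyperspecial (l. 5510) — REAL: `K` is hyperspecial-and-factorisable
  (`K = K^{(v)} · U(J)(𝒪_v)`) at every finite place `v` of `F` above `p`. -/
  K_hyperspecial : ∀ v : IsDedekindDomain.HeightOneSpectrum (𝓞 F), (p : 𝓞 F) ∈ v.asIdeal →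
    UnitaryGroup.IsHyperspecialAt F E (AppendixC.conj F E) D.V.n D.V.gram K v
  /-- The level «`K_Iw := Iw_𝔭 × K_p^𝔭 × K^p`», `Iw_𝔭 = (𝒪_𝔭 𝒪_𝔭; ϖ𝒪_𝔭 𝒪_𝔭) ⊆ GL₂(𝒪_𝔭)` an Iwahori subgroup (l. 5510) — pinned by
  `KIw_spec`. -/
  KIw : Subgroup D.V.Gfin
  /-- REAL pin of `K_Iw`: `k ∈ K_Iw` iff `k ∈ K` and the lower-left entry of its `𝔭`-component, read in `GL₂(E_𝔮)` through the
  split frame `e_𝔮`, lies in `ϖ𝒪_𝔭` (valuation `< 1`) — «`Iw_𝔭 = (𝒪_𝔭 𝒪_𝔭; ϖ𝒪_𝔭 𝒪_𝔭)`» (l. 5510; indices `1, 0` of `Fin 2` transported to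
  `Fin n` along `D.rank_eq_two`). -/
  KIw_spec : ∀ k : D.V.Gfin, k ∈ KIw ↔ k ∈ K ∧
    Valued.v (((UnitaryGroup.localPiSplitEquiv (AppendixC.conj F E) D.V.gram (AppendixC.conj_ne_one F E)
        D.V.gram_map_conj_transpose 𝔮 split gramUnit
        (UnitaryGroup.evalPlace F E (AppendixC.conj F E) D.V.n D.V.gram 𝔭 k) :
          GL (Fin D.V.n) (𝔮.1.adicCompletion E)) : Matrix (Fin D.V.n) (Fin D.V.n) (𝔮.1.adicCompletion E))
        (Fin.cast D.rank_eq_two.symm 1) (Fin.cast D.rank_eq_two.symm 0)) < 1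
  /-- `K_Iw` is a neat open compact subgroup. REAL. -/
  KIw_level : D.S.IsNeat KIw ∧ IsOpen (KIw : Set D.V.Gfin) ∧ IsCompact (KIw : Set D.V.Gfin)
  /-- `K_Iw ⊆ K` (l. 5510; a consequence of `KIw_spec`, kept as a field because the projection `π` below is the transition map
  `D.trBar KIw_le`). REAL. -/
  KIw_le : KIw ≤ K
  /-- ⟨CARRIER⟩ «an isomorphism `t_ϖ : S̄h(G,h)_{K_Iw} ≃ S̄h(G,h)_{K_Iw}` induced by the Hecke translation of the element `(0 ϖ; 1 0)`»
  (l. 5511–5514). -/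
  tϖ : D.ShBar KIw ≅ D.ShBar KIw
  /-- ⟨CARRIER⟩ «`⟨ϖ⟩ : S̄h(G,h)_K → S̄h(G,h)_K` the Hecke translation given by `diag(ϖ, ϖ)`» (Cor. D.9, l. 5584), an automorphism. -/
  diamond : D.ShBar K ≅ D.ShBar K
  /-- ⟨CARRIER⟩ «a smooth model `𝒮_K` over `𝒪_𝔭`» of «the smooth projective `F_𝔭`-curve `S̄h(G,h)_K`» (Prop. D.8 (1); l. 5520 «We will
  show in Proposition D.8 that `S̄h(G,h)_K` … admits a smooth model … `𝒮_K` … over `𝒪_𝔭`»): an integral model over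
  `𝒪_𝔭 = 𝔮.adicCompletionIntegers E` of the base change of `S̄h(G,h)_K` to `F_𝔭 = E_𝔮 = 𝔮.adicCompletion E` (tree
  `Motives.IntegralModel`, [SerreTate1968, §1]); that it IS smooth is Prop. D.8 (1), not a field. -/
  SK : IntegralModel (𝔮.1.adicCompletionIntegers E) (𝔮.1.adicCompletion E)
    ((Literature.AlgebraicGeometry.Motives.baseChange E (𝔮.1.adicCompletion E)).obj (D.ShBar K))
  /-- ⟨CARRIER⟩ «a stable model `𝒮_{K_Iw}` over `𝒪_𝔭`» of `S̄h(G,h)_{K_Iw}` (Prop. D.8 (2); l. 5520); that it IS (semi)stable is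
  Prop. D.8 (2), not a field. -/
  SKIw : IntegralModel (𝔮.1.adicCompletionIntegers E) (𝔮.1.adicCompletion E)
    ((Literature.AlgebraicGeometry.Motives.baseChange E (𝔮.1.adicCompletion E)).obj (D.ShBar KIw))
  /-- «`π` extends (uniquely) to a morphism `π : 𝒮_{K_Iw} → 𝒮_K`» (l. 5520). ⟨CARRIER⟩ morphism of `𝒪_𝔭`-schemes … -/
  πS : SKIw.total ⟶ SK.total
  /-- … whose generic fibre is `π ⊗ F_𝔭` (REAL compatibility with the generic isomorphisms of the two models). -/
  πS_generic : (Literature.AlgebraicGeometry.Motives.baseChange (𝔮.1.adicCompletionIntegers E) (𝔮.1.adicCompletion E)).map πS ≫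
      SK.genericIso.hom =
    SKIw.genericIso.hom ≫ (Literature.AlgebraicGeometry.Motives.baseChange E (𝔮.1.adicCompletion E)).map (D.trBar KIw_le)
  /-- «the morphism `t_ϖ` extends (uniquely) to a morphism `t_ϖ : 𝒮_{K_Iw} → 𝒮_{K_Iw}`, which has to be an isomorphism» (l. 5520,
  [LL99, Prop. 4.4 (a)]). ⟨CARRIER⟩ … -/
  tS : SKIw.total ≅ SKIw.total
  /-- … with generic fibre `t_ϖ ⊗ F_𝔭` (REAL). -/
  tS_generic : (Literature.AlgebraicGeometry.Motives.baseChange (𝔮.1.adicCompletionIntegers E) (𝔮.1.adicCompletion E)).map tS.hom ≫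
      SKIw.genericIso.hom =
    SKIw.genericIso.hom ≫ (Literature.AlgebraicGeometry.Motives.baseChange E (𝔮.1.adicCompletion E)).map tϖ.hom
  /-- ⟨CARRIER⟩ the component «`𝒯^+_{K_Iw}`» of the special fibre `𝒯_{K_Iw} = 𝒮_{K_Iw} ⊗_{𝒪_𝔭} κ` (Prop. D.8 (3)), as a `κ`-scheme … -/
  Tplus : SchemeOver (IsLocalRing.ResidueField (𝔮.1.adicCompletionIntegers E))
  /-- … with its closed immersion into `𝒯_{K_Iw}` (`IntegralModel.reduction` modulo the maximal ideal of `𝒪_𝔭`; `κ = 𝒪_𝔭/ϖ𝒪_𝔭` is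
  Mathlib's `IsLocalRing.ResidueField`). -/
  ιplus : Tplus ⟶ SKIw.reduction (IsLocalRing.maximalIdeal (𝔮.1.adicCompletionIntegers E))
  /-- ⟨CARRIER⟩ the component «`𝒯^−_{K_Iw}`» … -/
  Tminus : SchemeOver (IsLocalRing.ResidueField (𝔮.1.adicCompletionIntegers E))
  /-- … with its closed immersion into `𝒯_{K_Iw}`. -/
  ιminus : Tminus ⟶ SKIw.reduction (IsLocalRing.maximalIdeal (𝔮.1.adicCompletionIntegers E))
  /-- ⟨CARRIER⟩ «`t_ϖ ⊗ σ`» on `𝒯_{K_Iw} ⊗_κ κ^{ac}` (Prop. D.8 (3c); l. 5516: `σ` the `q`-th Frobenius of `𝒪_𝔭^{ur}`, acting on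
  `κ^{ac}`): an endomorphism of the underlying scheme of the `κ^{ac}`-base change of the special fibre, PINNED by its two
  projections (`tσ_fst`, `tσ_snd`): a morphism into the fibre product `𝒯_{K_Iw} ×_κ Spec κ^{ac}` is determined by them. -/
  tσ : ((Literature.AlgebraicGeometry.Motives.baseChange (IsLocalRing.ResidueField (𝔮.1.adicCompletionIntegers E))
      (AlgebraicClosure (IsLocalRing.ResidueField (𝔮.1.adicCompletionIntegers E)))).obj
      (SKIw.reduction (IsLocalRing.maximalIdeal (𝔮.1.adicCompletionIntegers E)))).left ⟶
    ((Literature.AlgebraicGeometry.Motives.baseChange (IsLocalRing.ResidueField (𝔮.1.adicCompletionIntegers E))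
      (AlgebraicClosure (IsLocalRing.ResidueField (𝔮.1.adicCompletionIntegers E)))).obj
      (SKIw.reduction (IsLocalRing.maximalIdeal (𝔮.1.adicCompletionIntegers E)))).left
  /-- REAL pin, first projection: `t_ϖ ⊗ σ` covers `t_ϖ ⊗ κ` on `𝒯_{K_Iw}` (the reduction of the extension `tS` of `t_ϖ`). -/
  tσ_fst : tσ ≫ Literature.AlgebraicGeometry.Motives.baseChangeHomFst (algebraMap (IsLocalRing.ResidueField (𝔮.1.adicCompletionIntegers E)) (AlgebraicClosure (IsLocalRing.ResidueField (𝔮.1.adicCompletionIntegers E)))) (SKIw.reduction (IsLocalRing.maximalIdeal (𝔮.1.adicCompletionIntegers E))) =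
    Literature.AlgebraicGeometry.Motives.baseChangeHomFst (algebraMap (IsLocalRing.ResidueField (𝔮.1.adicCompletionIntegers E)) (AlgebraicClosure (IsLocalRing.ResidueField (𝔮.1.adicCompletionIntegers E)))) (SKIw.reduction (IsLocalRing.maximalIdeal (𝔮.1.adicCompletionIntegers E))) ≫
      ((Literature.AlgebraicGeometry.Motives.baseChange (𝔮.1.adicCompletionIntegers E) (IsLocalRing.ResidueField (𝔮.1.adicCompletionIntegers E))).map tS.hom).left
  /-- REAL pin, second projection: `t_ϖ ⊗ σ` covers the `q`-th power Frobenius `σ` of `κ^{ac}` (`q = #κ`). -/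
  tσ_snd : ∃ σbar : (AlgebraicClosure (IsLocalRing.ResidueField (𝔮.1.adicCompletionIntegers E))) →+* (AlgebraicClosure (IsLocalRing.ResidueField (𝔮.1.adicCompletionIntegers E))), (∀ x, σbar x = x ^ Nat.card (IsLocalRing.ResidueField (𝔮.1.adicCompletionIntegers E))) ∧
    tσ ≫ ((Literature.AlgebraicGeometry.Motives.baseChange (IsLocalRing.ResidueField (𝔮.1.adicCompletionIntegers E)) (AlgebraicClosure (IsLocalRing.ResidueField (𝔮.1.adicCompletionIntegers E)))).obj (SKIw.reduction (IsLocalRing.maximalIdeal (𝔮.1.adicCompletionIntegers E)))).hom =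
      ((Literature.AlgebraicGeometry.Motives.baseChange (IsLocalRing.ResidueField (𝔮.1.adicCompletionIntegers E)) (AlgebraicClosure (IsLocalRing.ResidueField (𝔮.1.adicCompletionIntegers E)))).obj (SKIw.reduction (IsLocalRing.maximalIdeal (𝔮.1.adicCompletionIntegers E)))).hom ≫ Spec.map (CommRingCat.ofHom σbar)

namespace SecD4Data

variable {D}
variable (S4 : SecD4Data D)

/-- `𝒪_𝔭 := O_{F_𝔭} = O_{E_𝔮}` (l. 5508): Mathlib's `𝔮.adicCompletionIntegers E`. [cite: Liu2021, App. D §D.4 (l. 5508; p. 134)] -/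
abbrev O : Type := S4.𝔮.1.adicCompletionIntegers E

/-- `F_𝔭 = E_𝔮` (l. 5508): Mathlib's `𝔮.adicCompletion E`. [cite: Liu2021, App. D §D.4 (l. 5508; p. 134)] -/
abbrev Fp : Type := S4.𝔮.1.adicCompletion E

/-- «`κ := 𝒪_𝔭/ϖ𝒪_𝔭`» (l. 5508): the residue field of the local ring `𝒪_𝔭` (Mathlib `IsLocalRing.ResidueField` = the quotient by
the maximal ideal `ϖ𝒪_𝔭`). [cite: Liu2021, App. D §D.4 (l. 5508; p. 134)] -/
abbrev kappa : Type := IsLocalRing.ResidueField S4.O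

/-- «`q := #κ`» (l. 5508). [cite: Liu2021, App. D §D.4 (l. 5508; p. 134)] -/
def q : ℕ := Nat.card S4.kappa

/-- «`κ^{ac}`» (l. 5508), an algebraic closure of `κ`. [cite: Liu2021, App. D §D.4 (l. 5508; p. 134)] -/
abbrev kappaBar : Type := AlgebraicClosure S4.kappa

/-- «the projection morphism `π : S̄h(G,h)_{K_Iw} → S̄h(G,h)_K`» (l. 5510) — REAL: the transition map of the compactified system.
[cite: Liu2021, App. D §D.4 (l. 5510; p. 134)] -/
def proj : D.ShBar S4.KIw ⟶ D.ShBar S4.K := D.trBar S4.KIw_le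

/-- «`𝒯_K := 𝒮_K ⊗_{𝒪_𝔭} κ`» (l. 5520): the special fibre (tree `IntegralModel.reduction` modulo the maximal ideal).
[cite: Liu2021, App. D §D.4 (l. 5520; p. 135)] -/
def TK : SchemeOver S4.kappa := S4.SK.reduction (IsLocalRing.maximalIdeal S4.O)

/-- «`𝒯_{K_Iw} := 𝒮_{K_Iw} ⊗_{𝒪_𝔭} κ`» (l. 5520). [cite: Liu2021, App. D §D.4 (l. 5520; p. 135)] -/
def TKIw : SchemeOver S4.kappa := S4.SKIw.reduction (IsLocalRing.maximalIdeal S4.O)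

/-- `π` on special fibres, `𝒯_{K_Iw} → 𝒯_K` (the reduction of the extension `π : 𝒮_{K_Iw} → 𝒮_K`, l. 5520; used in Prop. D.8 (3a), (3b)).
[cite: Liu2021, Prop. D.8 (3) (p. 135)] -/
def projT : S4.TKIw ⟶ S4.TK :=
  (Literature.AlgebraicGeometry.Motives.baseChange S4.O S4.kappa).map S4.πS

/-- «`π^+ := π|𝒯^+_{K_Iw} : 𝒯^+_{K_Iw} → 𝒯_K`» (Prop. D.8 (3a)). [cite: Liu2021, Prop. D.8 (3a) (p. 135)] -/
def projPlus : S4.Tplus ⟶ S4.TK := S4.ιplus ≫ S4.projT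

/-- «`π^− := π|𝒯^−_{K_Iw} : 𝒯^−_{K_Iw} → 𝒯_K`» (Prop. D.8 (3b)). [cite: Liu2021, Prop. D.8 (3b) (p. 135)] -/
def projMinus : S4.Tminus ⟶ S4.TK := S4.ιminus ≫ S4.projT

/-- `𝒯_K ⊗_κ κ^{ac}` regarded as a scheme over `κ` (structure map through `Spec κ^{ac} → Spec κ`), the input of the tree's
`Motives.frobeniusOver` (whose underlying morphism is then the absolute `q`-th power Frobenius of the scheme `𝒯_K ⊗_κ κ^{ac}`,
`q = #κ`; Prop. D.8 (3d)). [cite: Liu2021, Prop. D.8 (3d) (p. 135)] -/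
def TKbarOverKappa : SchemeOver S4.kappa :=
  Over.mk (((Literature.AlgebraicGeometry.Motives.baseChange S4.kappa S4.kappaBar).obj S4.TK).hom ≫
    Spec.map (CommRingCat.ofHom (algebraMap S4.kappa S4.kappaBar)))

/-! ## Proposition D.8 (l. 5522–5540; p. 135 L5–17) -/

/-- **[Liu2021, Proposition D.8 (1)] EXACTLY AS PRINTED**: «The smooth projective `F_𝔭`-curve `S̄h(G,h)_K` admits a smooth model `𝒮_K`
over `𝒪_𝔭`» — for the posited model `𝒮_K` of the datum: it is smooth of relative dimension `1` and proper over `𝒪_𝔭` (tree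
`IntegralModel.IsSmoothProper 1`, [SerreTate1968, §1]). NO PROOF ([Car86, Prop. 6.1] &c., l. 5542–5576).
[cite: Liu2021, Prop. D.8 (1) (p. 135)] -/
def Liu2021_D8_1 (S4 : SecD4Data D) : Prop := S4.SK.IsSmoothProper 1

/-- **[Liu2021, Proposition D.8 (2)]** (typed up to the disclosed READING of «stable»): «The smooth projective `F_𝔭`-curve `S̄h(G,h)_{K_Iw}` admits a stable model
`𝒮_{K_Iw}` over `𝒪_𝔭`» — for the posited model `𝒮_{K_Iw}`: READING «stable model» = a SEMI-STABLE curve over `Spec 𝒪_𝔭` in the sense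
of [deJong1996, 2.21] (flat, proper, of finite presentation, geometric fibres connected nodal curves: tree
`ModuliOfCurves.IsSemiStableCurve`) whose generic fibre is the given smooth curve; the STABILITY refinement (finite automorphism
groups of the special fibre) is not typed. NO PROOF ([Car86, §6.7, Prop. 6.6], Grothendieck–Messing; l. 5542–5576).
[cite: Liu2021, Prop. D.8 (2) (p. 135)] -/
def Liu2021_D8_2 (S4 : SecD4Data D) : Prop := IsSemiStableCurve S4.SKIw.total.hom

/-- **[Liu2021, Proposition D.8 (3), first sentence]**: «The `κ`-scheme `𝒯_{K_Iw}` has two irreducible components `𝒯^+_{K_Iw}` and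
`𝒯^−_{K_Iw}`» — for the posited closed subschemes `ι± : 𝒯^± ↪ 𝒯_{K_Iw}`: both are closed immersions with irreducible source, their
images are two DISTINCT irreducible components of `𝒯_{K_Iw}` (Mathlib `irreducibleComponents`) and cover it.
[cite: Liu2021, Prop. D.8 (3) (p. 135)] -/
def Liu2021_D8_3 (S4 : SecD4Data D) : Prop :=
  IsClosedImmersion S4.ιplus.left ∧ IsClosedImmersion S4.ιminus.left ∧
  IrreducibleSpace S4.Tplus.left ∧ IrreducibleSpace S4.Tminus.left ∧
  Set.range S4.ιplus.left.base ∈ irreducibleComponents ↥S4.TKIw.left ∧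
  Set.range S4.ιminus.left.base ∈ irreducibleComponents ↥S4.TKIw.left ∧
  Set.range S4.ιplus.left.base ≠ Set.range S4.ιminus.left.base ∧
  Set.range S4.ιplus.left.base ∪ Set.range S4.ιminus.left.base = Set.univ

/-- **[Liu2021, Proposition D.8 (3a)] EXACTLY AS PRINTED**: «`π^+ := π|𝒯^+_{K_Iw} : 𝒯^+_{K_Iw} → 𝒯_K` is an isomorphism».
[cite: Liu2021, Prop. D.8 (3a) (p. 135)] -/
def Liu2021_D8_3a (S4 : SecD4Data D) : Prop := IsIso S4.projPlus

/-- **[Liu2021, Proposition D.8 (3b)]**: «`π^− := π|𝒯^−_{K_Iw} : 𝒯^−_{K_Iw} → 𝒯_K` is a finite flat morphism of degree `q`» — typed: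
finite and flat (Mathlib `IsFinite`, `Flat`); the clause «of degree `q`» (finite locally free of rank `q`) is NOT typed (no rank
of a finite flat morphism in Mathlib) and is recorded here. [cite: Liu2021, Prop. D.8 (3b) (p. 135)] -/
def Liu2021_D8_3b (S4 : SecD4Data D) : Prop := IsFinite S4.projMinus.left ∧ Flat S4.projMinus.left

/-- **[Liu2021, Proposition D.8 (3c), (3d)] EXACTLY AS PRINTED**: «(c) `t_ϖ ⊗ σ` induces an isomorphism between `𝒯^+_{K_Iw} ⊗_κ κ^{ac}`
and `𝒯^−_{K_Iw} ⊗_κ κ^{ac}`» — there is an isomorphism `f` of `κ^{ac}`-schemes with `f ≫ (ι^− ⊗ κ^{ac}) = (ι^+ ⊗ κ^{ac}) ≫ (t_ϖ ⊗ σ)`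
(`t_ϖ ⊗ σ` = the pinned `tσ`); «(d) the morphism `(π^− ⊗ id) ∘ (t_ϖ ⊗ σ) ∘ (π^+ ⊗ id)^{−1}` coincides with the absolute `q`-th
Frobenius morphism of `𝒯_K ⊗_κ κ^{ac}`» — written without the inverse: `f ≫ (π^− ⊗ id) = (π^+ ⊗ id) ≫ Frob_q` (equivalent given
(3a)), `Frob_q` REAL = `(Motives.frobeniusOver (𝒯_K ⊗_κ κ^{ac} over κ)).left` ([Milne, Étale cohomology VI §13]; needs `κ` finite,
taken as an instance hypothesis — the residue field of `E_𝔮` is finite, a fact Mathlib does not register as an instance).  NO PROOF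
([Car86, §10.3, Prop. 10.3], [SP, 0CCZ]). [cite: Liu2021, Prop. D.8 (3c)–(3d) (p. 135)] -/
def Liu2021_D8_3cd (S4 : SecD4Data D) : Prop :=
  ∀ [Finite S4.kappa],
  ∃ f : (Literature.AlgebraicGeometry.Motives.baseChange S4.kappa S4.kappaBar).obj S4.Tplus ≅
      (Literature.AlgebraicGeometry.Motives.baseChange S4.kappa S4.kappaBar).obj S4.Tminus,
    f.hom.left ≫ ((Literature.AlgebraicGeometry.Motives.baseChange S4.kappa S4.kappaBar).map S4.ιminus).left =
      ((Literature.AlgebraicGeometry.Motives.baseChange S4.kappa S4.kappaBar).map S4.ιplus).left ≫ S4.tσ ∧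
    f.hom.left ≫ ((Literature.AlgebraicGeometry.Motives.baseChange S4.kappa S4.kappaBar).map S4.projMinus).left =
      ((Literature.AlgebraicGeometry.Motives.baseChange S4.kappa S4.kappaBar).map S4.projPlus).left ≫
        (Literature.AlgebraicGeometry.Motives.frobeniusOver S4.TKbarOverKappa).left

/-- **[Liu2021, Proposition D.8]**, all typed clauses: (1) ∧ (2) ∧ (3) ∧ (3a) ∧ (3b) ∧ (3c–d). [cite: Liu2021, Prop. D.8 (p. 135)] -/
def Liu2021_D8 (S4 : SecD4Data D) : Prop :=
  S4.Liu2021_D8_1 ∧ S4.Liu2021_D8_2 ∧ S4.Liu2021_D8_3 ∧ S4.Liu2021_D8_3a ∧ S4.Liu2021_D8_3b ∧ S4.Liu2021_D8_3cd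

/-! ## Corollary D.9 (l. 5579–5585; p. 138 L44 – p. 139 L2) -/

/-- The Hecke operators `T_{𝔮,i} = [K diag(ϖ^{(i)}) K]` (`i` entries `ϖ`) on `H¹_ét(S̄h(G,h), ℚ_ℓ^{ac})` at the split place `𝔮`:
the tree's `UnitaryGroup.heckeTAt` for the representation `ρet`, the level `K`, the REAL split frame at `𝔮` and the chosen
uniformizer `ϖ = GaloisRepresentations.HeckeCharacter.uniformizer E 𝔮` of `E_𝔮 = F_𝔭`; `T_{𝔮,1} = t_ϖ^*`, `T_{𝔮,2} = ⟨ϖ⟩^*` in Cor. D.9.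
[cite: Liu2021, Cor. D.9 (p. 138)] -/
def heckeT {ℓ : ℕ} [Fact ℓ.Prime] (L : D.EllAdic ℓ) (i : ℕ) : Module.End (PadicAlgCl ℓ) L.H1et :=
  UnitaryGroup.heckeTAt F E (AppendixC.conj F E) D.V.n D.V.gram L.ρet S4.K S4.𝔮 (AppendixC.conj_ne_one F E)
    D.V.gram_map_conj_transpose S4.split S4.gramUnit (GaloisRepresentations.HeckeCharacter.uniformizer E S4.𝔮.1) i

/-- **[Liu2021, Corollary D.9] EXACTLY AS PRINTED**, for a prime `ℓ` with `ℓ`-adic data `L`: «For every rational prime `ℓ ≠ p`, the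
action `(σ^{−1})^*` of the *geometric* Frobenius at `𝔮` on `H¹_ét(S̄h(G,h)_K ⊗_E ℂ, ℚ_ℓ^{ac})` satisfies the equation
`X² − t_ϖ^* X + q⟨ϖ⟩^* = 0`, where `⟨ϖ⟩` is the Hecke translation given by `diag(ϖ, ϖ)`. Here, we regard `t_ϖ` as a correspondence
on `S̄h(G,h)_K`.»  READINGS: `H¹_ét(S̄h_K ⊗_E ℂ, ℚ_ℓ^{ac})` = the `K`-fixed vectors `L.H1etLevel K` of the limit (READING G1 for the
Galois group); «the geometric Frobenius at `𝔮`» = any `Φ ∈ Γ_E` that is a geometric Frobenius at a prime `𝔓` of `Ē` above `𝔮`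
(tree `IsGeomFrobAt`; the action on `H¹` of a curve with good reduction at `𝔮` — Prop. D.8 (1) — is unramified, so the choice is
immaterial), acting through `L.γet`; `t_ϖ^* = T_{𝔮,1} = [K diag(ϖ,1) K]` (the correspondence `t_ϖ` through `K_Iw` and
`(0 ϖ; 1 0) ∈ diag(ϖ,1) GL₂(𝒪_𝔭)` is the double coset `K diag(ϖ,1) K`) and `⟨ϖ⟩^* = T_{𝔮,2} = [K diag(ϖ,ϖ) K]` are the tree's Hecke
operators `heckeT L 1`, `heckeT L 2` (`UnitaryGroup.heckeTAt`, the REAL split frame at `𝔮` and a uniformizer `ϖ` of `E_𝔮 = F_𝔭`),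
on the smooth `G(𝔸^∞)`-module `H¹_ét(S̄h(G,h), ℚ_ℓ^{ac})` read as the PULL-BACK action (`AppendixC/ThmD6CompositionGeneric`:
«`heckeOperator … = Σ_{y ∈ KtK/K} T_y^*` is print's `t_ϖ^*`»).  The identity is stated on every `K`-fixed vector.  NO PROOF
(Prop. D.8 (3), (3a), (3d); l. 5587–5615). [cite: Liu2021, Cor. D.9 (p. 138)] -/
def Liu2021_D9 (S4 : SecD4Data D) {ℓ : ℕ} [Fact ℓ.Prime] (L : D.EllAdic ℓ) : Prop :=
  ℓ ≠ S4.p →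
    ∀ (𝔓 : Ideal (Literature.NumberTheory.GaloisRepresentations.absIntegers (𝓞 E) E)) (Φ : Field.absoluteGaloisGroup E),
      𝔓 ∈ S4.𝔮.1.primesAbove → Literature.NumberTheory.GaloisRepresentations.IsGeomFrobAt (𝓞 E) Φ 𝔓 →
      ∀ v ∈ L.H1etLevel S4.K,
        L.γet Φ (L.γet Φ v) - S4.heckeT L 1 (L.γet Φ v) + (S4.q : PadicAlgCl ℓ) • S4.heckeT L 2 v = 0

end SecD4Data

/-! ## §D.4, proof of Theorem D.6 (1): the paragraph l. 5626–5627 (p. 140 L20–31) -/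

/-- ⟨CARRIER⟩ the rational Betti realisation «`H¹_B(−, ℚ)`» of abelian varieties over `E` (via `τ'₁ : E ↪ ℂ`), used by the
paragraph l. 5626–5627 («`φ^* : H¹_B(B, ℚ) → H¹_B(A_K, ℚ)[π̲^∞]`»): a `ℚ`-space for every abelian variety with contravariant
functoriality, and the isotypic piece `H¹_B(A_K, ℚ)[π̲^∞]` of an orbit at level `K` (through «the canonical isomorphism in
Lemma 2.4(1)» `H¹_B(A_K) ≅ H¹_B(S̄h_K)` and the Hecke action).  (REAL candidates: tree `Literature.bettiCohomology (A.X) 1` under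
`Algebra E ℂ := τ'₁`; docking left to the consumer, TODO(dock-betti).)  Nothing is asserted. [cite: Liu2021, App. D §D.4 (l. 5626–5627; p. 140)] -/
structure BettiQData (D : SecD3Data F E) : Type 1 where
  /-- ⟨CARRIER⟩ `H¹_B(A, ℚ)` for an abelian variety `A` over `E`. -/
  H1Q : AbelianVariety E → ModuleCat.{0} ℚ
  /-- ⟨CARRIER⟩ pull-back `φ^* : H¹_B(B, ℚ) → H¹_B(A, ℚ)` along `φ : A → B`. -/
  pull : ∀ {A B : AbelianVariety E}, (A ⟶ B) → (H1Q B →ₗ[ℚ] H1Q A)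
  /-- functoriality: identity. -/
  pull_id : ∀ A, pull (𝟙 A) = LinearMap.id
  /-- functoriality: composition. -/
  pull_comp : ∀ {A B C : AbelianVariety E} (f : A ⟶ B) (g : B ⟶ C), pull (f ≫ g) = pull f ∘ₗ pull g
  /-- ⟨CARRIER⟩ «`H¹_B(A_K, ℚ)[π̲^∞]`», the isotypic piece of the `Gal(ℂ/ℚ)`-orbit of the class `i` in `H¹_B(A_K, ℚ)` (l. 5626), at a
  neat open compact level `K` (where `A_K` exists). -/
  isotypicQ : ∀ (K : Subgroup D.V.Gfin) (hn : D.S.IsNeat K) (hK : IsOpenCompact K), D.Irr → Submodule ℚ (H1Q (D.jac K hn hK).J)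
  /-- the isotypic piece depends only on the orbit. -/
  isotypicQ_orbit : ∀ (K : Subgroup D.V.Gfin) (hn : D.S.IsNeat K) (hK : IsOpenCompact K) (σ : ℂ ≃ₐ[ℚ] ℂ) (i : D.Irr),
    isotypicQ K hn hK (D.galAct σ i) = isotypicQ K hn hK i

/-- «`B₀` has complex multiplications by some subfield `M₀ ⊆ ℂ`» (l. 5627): there is a `ℚ`-algebra embedding `M₀ ↪ End_E(B₀)_ℚ`
with `[M₀:ℚ] = 2 dim B₀` (READING: CM by the FIELD `M₀` in the usual sense for a simple `B₀`). [cite: Liu2021, App. D §D.4 (l. 5627; p. 140)] -/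
def HasCMBy (B₀ : AbelianVariety E) (M₀ : IntermediateField ℚ ℂ) : Prop :=
  Nonempty (M₀ →ₐ[ℚ] B₀.endAlgebra) ∧ Module.finrank ℚ M₀ = 2 * B₀.dim

/-- **[Liu2021, App. D §D.4, l. 5626–5627 (p. 140 L20–31)] EXACTLY AS PRINTED** — the paragraph of the proof of Thm. D.6 (1)
cited by the tree as «§D.4 (FJcycle.tex l. 5626–5627)»: for `π^∞ ≃ ω(μ, ε, χ)` endoscopic cohomological with `μ` of weight one,
`τ'₁ ∈ Φ_μ`, «Fix an open compact subgroup `K ⊆ G(𝔸^∞)` such that `(π^K)^∞ ≠ {0}`. Let `A_K` be the Jacobian of `S̄h(G,h)_K`. Let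
`π̲^∞` be the `Gal(ℂ/ℚ)`-orbit of `π^∞`. Using Hecke operators, we may find a surjective homomorphism `φ : A_K → B` of abelian
varieties over `E` such that the induced map `φ^* : H¹_B(B, ℚ) → H¹_B(A_K, ℚ)[π̲^∞]` is an isomorphism. Let `B₀` be some simple factor
of `B` over `E`. Then `B₀` has complex multiplications by some subfield `M₀ ⊆ ℂ`, which has to contain `M'_μ` (Definition 4.3).»
READINGS: «simple factor of `B`» = a simple abelian variety with a closed-immersion homomorphism into `B`; `M'_μ` = the reflex field
of `(E, Φ_μ)` = tree `ComplexMultiplication.traceField Φ_μ` (as in `IdeleClassCharacterAlgebraicTwist` §7); `φ^*` «is an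
isomorphism» onto the isotypic piece = injective with range the piece; «open compact subgroup `K`» read as a neat open compact
level (`K` sufficiently small so that `S̄h(G,h)_K` and `A_K` exist).  A step of a printed PROOF, typed because 23 tree files
cite it; NO PROOF. [cite: Liu2021, App. D §D.4 (l. 5626–5627; p. 140)] -/
def Liu2021_D4par_heckeProjection (D : SecD3Data F E) (𝓑 : BettiQData D) : Prop :=
  letI : IsCMField E := isCMField F E
  ∀ (i : D.Irr) (t : D.Triple) (Φ : CMType E) (K : Subgroup D.V.Gfin),
    D.Liu2021_D3_isEndoscopicCohomological i → D.IsOmega i t → D.IsWeightOneAtTau1 t →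
    IdeleClassGroup.HasCMType E (D.tμ t) Φ → ∀ (hn : D.S.IsNeat K) (hK : IsOpenCompact K), 0 < D.dimFixed K i →
      ∃ (B : AbelianVariety E) (φ : (D.jac K hn hK).J ⟶ B),
        Surjective (AbelianVariety.Hom.toSchemeHom φ) ∧
        Function.Injective (𝓑.pull φ) ∧ LinearMap.range (𝓑.pull φ) = 𝓑.isotypicQ K hn hK i ∧
        ∀ (B₀ : AbelianVariety E) (f : B₀ ⟶ B), AbelianVariety.IsSimple B₀ →
          IsClosedImmersion (AbelianVariety.Hom.toSchemeHom f) → 0 < B₀.dim →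
            ∃ M₀ : IntermediateField ℚ ℂ, HasCMBy B₀ M₀ ∧ ComplexMultiplication.traceField Φ ≤ M₀

end Literature.NumberTheory.Automorphic.Liu2021.AppendixD.SecD4ProofOfThmD6

end
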